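import Literature.AlgebraicGeometry.HodgeTheory.AbelianVarietyCommutativeEndSubvarieties
import Literature.AlgebraicGeometry.Motives.AbelianVarietyEndAlgebraSemisimpleProofs
import Literature.AlgebraicGeometry.Motives.AbelianVarietyEndAlgebraIsogenyInvariance
import Literature.AlgebraicGeometry.Motives.AbelianVarietyBiproductIsogenies
import HarnessLib

/-!
# `End⁰(X) = ℚ ⊗ End X` is reduced iff `End X` is; reducedness of `End X` and finiteness of the lattice of abelian
# subvarieties are ISOGENY INVARIANTS (Mumford §19 Thm. 3, Cor. 1–2 of Thm. 1; Zarhin 2008 Thm. 3.2)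

Layer `Literature/AlgebraicGeometry/HodgeTheory`; theorems only (no `def`, no instance, no named fact; net debt 0).  The file
lifts `HodgeTheory/AbelianVarietyEndReducedIffMultiplicityFree` (finitely many abelian subvarieties ⟺ `End X` reduced, perfect
field) from the order `End X` to the algebra `End⁰(X) = ℚ ⊗_ℤ End X`, which — unlike `End X` — is an isogeny invariant
(`Motives/AbelianVarietyEndAlgebraIsogenyInvariance`: `X ∼ X' ⟹ End⁰ X ≃ₐ[ℚ] End⁰ X'`).  §1 holds over ANY field: `End X ↪ End⁰ X`
is injective (`End X` is torsion-free, Mumford §19 Thm. 3) and every element of `End⁰ X` is `M⁻¹ · (1 ⊗ F)`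
(`Motives/AbelianVarietyEndAlgebraSemisimpleProofs.endAlgebra.exists_eq_algebraMap_mul_of`), so nilpotents of `End⁰ X` are the
`ℚˣ`-multiples of nilpotents of `End X`; hence `End⁰ X` is reduced iff `End X` is, and BOTH properties are isogeny invariants.
§2 is over a PERFECT field (isotypic components exist): `End⁰ X` reduced ⟺ multiplicity-free ⟺ finitely many abelian
subvarieties ⟺ `X ∼ ⨁` pairwise non-isogenous simple; a commutative `End⁰ X` is reduced (the any-perfect-field form of the
`K = ℂ` statement `ComplexMultiplication/EndAlgebraCommutativeDegree.isReduced_endAlgebra_of_comm`); and the finiteness and the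
number of abelian subvarieties are isogeny invariants.

THE PRINT.  Mumford, *Abelian Varieties* (1970) §19 Thm. 3 (p. 176: `Hom(X,Y)` is a finitely generated free abelian group, so
`End X ⊂ End⁰ X = End X ⊗ ℚ`), Cor. 1–2 of Thm. 1 (pp. 173–174: `X ∼ ∏ X_i^{n_i}`, `End⁰ X = ⊕ M_{n_i}(D_i)`, `D_i = End⁰ X_i`
division algebras — reduced iff every `n_i = 1`, and `End⁰ X` depends only on the isogeny class of `X`); Milne, *Abelian
Varieties* (1986) §12 p. 122 (PDF p. 189: the `r_i` and the `A_i` up to isogeny are uniquely determined); Zarhin 2008 Thm. 3.2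
(p. 7; Lenstra–Oort–Zarhin 1996) for the finiteness of abelian subvarieties.  For a simple `X`, `End⁰ X` is a division algebra,
hence reduced: `ComplexMultiplication/CMTypeOfSimpleSubvariety.isReduced_endAlgebra_of_isSimple` (any field; not restated).

Results (namespace `Literature.AlgebraicGeometry.HodgeTheory.AbelianVariety`):
* §1 (any field) `isNilpotent_endAlgebra_of_iff`, `isNilpotent_algebraMap_mul_endAlgebra_of_iff`,
  **`isReduced_endAlgebra_iff_isReduced_end`**, `exists_ne_zero_mul_self_eq_zero_endAlgebra_iff`,
  `isReduced_endAlgebra_iff_of_isIsogenous`, **`isReduced_end_iff_of_isIsogenous`** (reducedness of `End X` is an isogeny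
  invariant), `isReduced_endAlgebra_of_isSimple_components`, `not_isReduced_endAlgebra_of_component`,
  `not_isReduced_endAlgebra_biprod_self`, `not_isReduced_end_of_isIsogenous_biprod_self`,
  **`not_isReduced_end_biprod_of_isIsogenous`** (`B ⊞ B'` with `B ∼ B'`, `0 < dim B`), `not_isReduced_endAlgebra_biprod_of_isIsogenous`;
* §2 (perfect field) `isReduced_endAlgebra_iff_forall_multiplicity_eq_zero`,
  **`finite_setOf_range_subvariety_iff_isReduced_endAlgebra`**, `isReduced_endAlgebra_iff_exists_isIsogenous_biproduct_simple`,
  **`isReduced_endAlgebra_of_forall_comm_endAlgebra`**, `isReduced_end_of_forall_comm_endAlgebra`,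
  **`finite_setOf_range_subvariety_iff_of_isIsogenous`**, `infinite_setOf_range_subvariety_iff_of_isIsogenous`,
  **`natCard_setOf_range_subvariety_eq_of_isIsogenous`** (isogenous abelian varieties have the same number of abelian
  subvarieties).

## References
* [MumfordAV1970] D. Mumford, *Abelian Varieties* (1970), §19 Thm. 1, Cor. 1–2, Thm. 3 (pp. 173–176).
* [Milne1986AbelianVarieties] J. S. Milne, *Abelian Varieties*, in Cornell–Silverman (1986), §12 Prop. 12.1, Lemma 12.2 and
  p. 122 (PDF p. 189).
* [Zarhin2008HomomorphismsFiniteFields] Yu. G. Zarhin, *Homomorphisms of abelian varieties over finite fields* (2008)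
  (arXiv:0711.1615), Thm. 3.2 (p. 7).
* [Shimura1998] G. Shimura, *Abelian Varieties with Complex Multiplication and Modular Functions* (1998), §5.1 Prop. 1, 3–4.
-/

noncomputable section

universe u

open CategoryTheory CategoryTheory.Limits

namespace Literature.AlgebraicGeometry.HodgeTheory

namespace AbelianVariety

open _root_.AlgebraicGeometry
open Literature.AlgebraicGeometry.Motives Literature.AlgebraicGeometry.Motives.AbelianVariety

variable {K : Type u} [Field K]

/-! ## §1 Nilpotents of `End⁰ X` versus nilpotents of `End X` (any field) -/

section AnyField

variable {X X' : Motives.AbelianVariety K}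

/-- `1 ⊗ φ ∈ End⁰ X` is nilpotent iff `φ ∈ End X` is (`End X ↪ End⁰ X`, Mumford §19 Thm. 3).
[cite: MumfordAV1970, §19 Thm. 3 (p. 176)] -/
theorem isNilpotent_endAlgebra_of_iff (φ : End X) : IsNilpotent (endAlgebra.of X φ) ↔ IsNilpotent φ := by
  refine ⟨fun ⟨n, hn⟩ ↦ ⟨n, endAlgebra.of_injective_of_isIsogeny_zsmul_id (isIsogeny_zsmul_id_holds X) ?_⟩,
    fun h ↦ h.map _⟩
  rw [map_pow, hn, map_zero]

/-- `q · (1 ⊗ φ) ∈ End⁰ X` (`q ∈ ℚˣ`) is nilpotent iff `φ ∈ End X` is. [cite: MumfordAV1970, §19 Thm. 3 (p. 176)] -/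
theorem isNilpotent_algebraMap_mul_endAlgebra_of_iff {q : ℚ} (hq : q ≠ 0) (φ : End X) :
    IsNilpotent (algebraMap ℚ X.endAlgebra q * endAlgebra.of X φ) ↔ IsNilpotent φ := by
  rw [← isNilpotent_endAlgebra_of_iff]
  have hc : ∀ n : ℕ, (algebraMap ℚ X.endAlgebra q * endAlgebra.of X φ) ^ n =
      algebraMap ℚ X.endAlgebra (q ^ n) * endAlgebra.of X φ ^ n := fun n ↦ by
    rw [(Algebra.commute_algebraMap_left q (endAlgebra.of X φ)).mul_pow, map_pow]
  constructor
  · rintro ⟨n, hn⟩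
    refine ⟨n, ?_⟩
    rw [hc n] at hn
    exact (IsUnit.mul_right_eq_zero ((IsUnit.mk0 _ (pow_ne_zero n hq)).map _)).1 hn
  · rintro ⟨n, hn⟩
    exact ⟨n, by rw [hc n, hn, mul_zero]⟩

/-- **`End⁰ X` IS REDUCED IFF `End X` IS** (any field): `End X ↪ End⁰ X`, and a nilpotent `x = M⁻¹ · (1 ⊗ F) ∈ End⁰ X` has
`F` nilpotent. [cite: MumfordAV1970, §19 Thm. 3 (p. 176) and Cor. 2 of Thm. 1 (p. 174)] -/
theorem isReduced_endAlgebra_iff_isReduced_end : IsReduced X.endAlgebra ↔ _root_.IsReduced (End X) := by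
  constructor
  · intro _
    exact isReduced_of_injective (endAlgebra.of X)
      (endAlgebra.of_injective_of_isIsogeny_zsmul_id (isIsogeny_zsmul_id_holds X))
  · intro hR
    refine ⟨fun x hx ↦ ?_⟩
    obtain ⟨M, F, hM, rfl⟩ := endAlgebra.exists_eq_algebraMap_mul_of x
    have hF : IsNilpotent F :=
      (isNilpotent_algebraMap_mul_endAlgebra_of_iff (inv_ne_zero (Nat.cast_ne_zero.2 hM)) F).1 hx
    rw [hR.eq_zero F hF, map_zero, mul_zero]

/-- Non-zero square-zero elements of `End⁰ X` come from non-zero square-zero endomorphisms of `X` and conversely (any field).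
[cite: MumfordAV1970, §19 Thm. 3 (p. 176) and Cor. 2 of Thm. 1 (p. 174)] -/
theorem exists_ne_zero_mul_self_eq_zero_endAlgebra_iff :
    (∃ x : X.endAlgebra, x ≠ 0 ∧ x * x = 0) ↔ ∃ φ : X ⟶ X, φ ≠ 0 ∧ φ ≫ φ = 0 := by
  have hinj := endAlgebra.of_injective_of_isIsogeny_zsmul_id (isIsogeny_zsmul_id_holds X)
  constructor
  · rintro ⟨x, hx, hxx⟩
    obtain ⟨M, F, hM, rfl⟩ := endAlgebra.exists_eq_algebraMap_mul_of x
    set c : X.endAlgebra := algebraMap ℚ X.endAlgebra (M : ℚ)⁻¹ with hc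
    have hcu : IsUnit (c * c) := by
      rw [hc, ← map_mul]
      exact (IsUnit.mk0 _ (mul_ne_zero (inv_ne_zero (Nat.cast_ne_zero.2 hM))
        (inv_ne_zero (Nat.cast_ne_zero.2 hM)))).map _
    have h1 : c * endAlgebra.of X F * (c * endAlgebra.of X F) = c * c * endAlgebra.of X (F * F) := by
      rw [map_mul, mul_assoc c (endAlgebra.of X F), ← mul_assoc (endAlgebra.of X F) c,
        (Algebra.commute_algebraMap_right ((M : ℚ)⁻¹) (endAlgebra.of X F)).eq, mul_assoc c, ← mul_assoc c c]
    have hFF : F * F = 0 := hinj (by rw [map_zero]; exact (hcu.mul_right_eq_zero).1 (h1 ▸ hxx))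
    refine ⟨F, fun hF0 ↦ hx ?_, by rw [← End.mul_def]; exact hFF⟩
    rw [show F = (0 : End X) from hF0, map_zero, mul_zero]
  · rintro ⟨φ, hφ, hφφ⟩
    refine ⟨endAlgebra.of X (End.of φ), fun h ↦ hφ ?_, ?_⟩
    · have h0 : End.of φ = 0 := hinj (h.trans (map_zero (endAlgebra.of X)).symm)
      exact h0
    rw [← map_mul, End.mul_def]
    change endAlgebra.of X (End.of (φ ≫ φ)) = 0
    rw [hφφ]
    exact map_zero _

/-- `End⁰ X` reduced is an isogeny invariant (`X ∼ X' ⟹ End⁰ X ≃ₐ[ℚ] End⁰ X'`). [cite: MumfordAV1970, §19 Cor. 2 of Thm. 1 and Remark p. 169]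
[cite: Milne1986AbelianVarieties, §12 p. 122 (PDF p. 189)] -/
theorem isReduced_endAlgebra_iff_of_isIsogenous (h : IsIsogenous X X') : IsReduced X.endAlgebra ↔ IsReduced X'.endAlgebra := by
  obtain ⟨e⟩ := h.nonempty_endAlgebra_algEquiv
  exact ⟨fun _ ↦ isReduced_of_injective e.symm.toRingEquiv e.symm.toRingEquiv.injective,
    fun _ ↦ isReduced_of_injective e.toRingEquiv e.toRingEquiv.injective⟩

/-- **REDUCEDNESS OF `End X` IS AN ISOGENY INVARIANT** (any field): although `End X` itself is not an isogeny invariant,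
`End⁰ X` is, and `End X` is reduced iff `End⁰ X` is. [cite: MumfordAV1970, §19 Thm. 3 (p. 176) and Cor. 2 of Thm. 1 (p. 174)]
[cite: Milne1986AbelianVarieties, §12 p. 122 (PDF p. 189)] -/
theorem isReduced_end_iff_of_isIsogenous (h : IsIsogenous X X') : _root_.IsReduced (End X) ↔ _root_.IsReduced (End X') := by
  rw [← isReduced_endAlgebra_iff_isReduced_end, ← isReduced_endAlgebra_iff_isReduced_end,
    isReduced_endAlgebra_iff_of_isIsogenous h]

variable {Q : Type} [Fintype Q] {Y : Q → Motives.AbelianVariety K}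

/-- Multiplicity-free ⟹ `End⁰ X` reduced (any field): a `Hom`-orthogonal system of SIMPLE abelian subvarieties
`i_q : Y_q ↪ X` with `⨁ Y_q → X` an isogeny. [cite: MumfordAV1970, §19 Cor. 2 of Thm. 1 (p. 174: `End⁰ X = ⊕ D_i` when all `n_i = 1`)] -/
theorem isReduced_endAlgebra_of_isSimple_components (i : ∀ q, Y q ⟶ X)
    (hi : ∀ q, IsClosedImmersion (Hom.toSchemeHom (i q))) (hdesc : IsIsogeny (biproduct.desc i))
    (horth : ∀ q q', q ≠ q' → ∀ f : Y q ⟶ Y q', f = 0) (hYs : ∀ q, (Y q).IsSimple) : IsReduced X.endAlgebra :=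
  isReduced_endAlgebra_iff_isReduced_end.2 (isReduced_end_of_isSimple_components i hi hdesc horth hYs)

omit [Fintype Q] in
/-- A repeated factor (`Y_q ∼ B^ι` with two indices, `0 < dim B`) makes `End⁰ X` non-reduced (any field).
[cite: MumfordAV1970, §19 Cor. 2 of Thm. 1 (p. 174: `M_n(D)`, `n ≥ 2`, has nilpotents)] -/
theorem not_isReduced_endAlgebra_of_component [Fintype Q] (i : ∀ q, Y q ⟶ X)
    (hi : ∀ q, IsClosedImmersion (Hom.toSchemeHom (i q))) (hdesc : IsIsogeny (biproduct.desc i)) {q : Q}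
    {B : Motives.AbelianVariety K} {ι : Type} [Fintype ι] (hY : IsIsogenous (Y q) (⨁ fun _ : ι ↦ B)) {k₀ k₁ : ι}
    (hk : k₀ ≠ k₁) (hB : 0 < B.dim) : ¬ IsReduced X.endAlgebra := by
  rw [isReduced_endAlgebra_iff_isReduced_end]
  exact not_isReduced_end_of_component i hi hdesc hY hk hB

/-- `End⁰(B ⊞ B)` is not reduced for `0 < dim B` (any field). [cite: MumfordAV1970, §19 Cor. 2 of Thm. 1 (p. 174)] -/
theorem not_isReduced_endAlgebra_biprod_self {B : Motives.AbelianVariety K} (hB : 0 < B.dim) :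
    ¬ IsReduced (B ⊞ B).endAlgebra := by
  rw [isReduced_endAlgebra_iff_isReduced_end]
  exact not_isReduced_end_biprod_self hB

/-- `X ∼ B ⊞ B` with `0 < dim B` ⟹ `End X` is not reduced (any field; isogeny invariance).
[cite: MumfordAV1970, §19 Cor. 2 of Thm. 1 (p. 174)] -/
theorem not_isReduced_end_of_isIsogenous_biprod_self {B : Motives.AbelianVariety K} (h : IsIsogenous X (B ⊞ B))
    (hB : 0 < B.dim) : ¬ _root_.IsReduced (End X) := by
  rw [isReduced_end_iff_of_isIsogenous h]
  exact not_isReduced_end_biprod_self hB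

/-- **`End(B ⊞ B')` IS NOT REDUCED FOR ISOGENOUS `B ∼ B'` OF POSITIVE DIMENSION** (any field; e.g. a product of two isogenous
elliptic curves): `𝟙 ⊞ e : B ⊞ B → B ⊞ B'` is an isogeny for an isogeny `e`. [cite: MumfordAV1970, §19 Cor. 2 of Thm. 1 (p. 174) and Remark p. 169] -/
theorem not_isReduced_end_biprod_of_isIsogenous {B B' : Motives.AbelianVariety K} (h : IsIsogenous B B') (hB : 0 < B.dim) :
    ¬ _root_.IsReduced (End (B ⊞ B')) := by
  obtain ⟨e, he⟩ := h
  have h' : IsIsogenous (B ⊞ B) (B ⊞ B') := ⟨biprod.map (𝟙 B) e, (isIsogeny_id B).biprod_map he⟩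
  exact not_isReduced_end_of_isIsogenous_biprod_self h'.symm' hB

/-- `End⁰(B ⊞ B')` is not reduced for isogenous `B ∼ B'` of positive dimension (any field).
[cite: MumfordAV1970, §19 Cor. 2 of Thm. 1 (p. 174)] -/
theorem not_isReduced_endAlgebra_biprod_of_isIsogenous {B B' : Motives.AbelianVariety K} (h : IsIsogenous B B')
    (hB : 0 < B.dim) : ¬ IsReduced (B ⊞ B').endAlgebra := by
  rw [isReduced_endAlgebra_iff_isReduced_end]
  exact not_isReduced_end_biprod_of_isIsogenous h hB

end AnyField

/-! ## §2 Over a perfect field: `End⁰ X` reduced ⟺ finitely many abelian subvarieties; isogeny invariance -/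

section Perfect

variable {Q : Type} [Fintype Q] {B : Q → Motives.AbelianVariety K} {n : Q → ℕ} {X X' : Motives.AbelianVariety K}
  {Y : Q → Motives.AbelianVariety K}

variable [PerfectField K]

/-- **`End⁰ X` IS REDUCED IFF `X` IS MULTIPLICITY-FREE** (perfect field; isotypic components `Y_q ∼ B_q^{n_q+1}`, `B_q` simple
of positive dimension pairwise non-isogenous, addition map an isogeny). [cite: MumfordAV1970, §19 Cor. 2 of Thm. 1 (p. 174)]
[cite: Milne1986AbelianVarieties, §12 p. 122 (PDF p. 189)] -/
theorem isReduced_endAlgebra_iff_forall_multiplicity_eq_zero (hB : ∀ q, (B q).IsSimple) (hB0 : ∀ q, 0 < (B q).dim)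
    (hni : ∀ q q', q ≠ q' → ¬ IsIsogenous (B q) (B q')) (hY : ∀ q, IsIsogenous (Y q) (⨁ fun _ : Fin (n q + 1) ↦ B q))
    (i : ∀ q, Y q ⟶ X) (hi : ∀ q, IsClosedImmersion (Hom.toSchemeHom (i q))) (hdesc : IsIsogeny (biproduct.desc i)) :
    IsReduced X.endAlgebra ↔ ∀ q, n q = 0 := by
  rw [isReduced_endAlgebra_iff_isReduced_end, isReduced_end_iff_forall_multiplicity_eq_zero hB hB0 hni hY i hi hdesc]

/-- **AN ABELIAN VARIETY HAS FINITELY MANY ABELIAN SUBVARIETIES IFF ITS ENDOMORPHISM ALGEBRA `End⁰ X` IS REDUCED** (perfect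
field; abelian subvarieties recorded by their closed subsets). [cite: MumfordAV1970, §19 Cor. 1–2 of Thm. 1 (pp. 173–174)]
[cite: Zarhin2008HomomorphismsFiniteFields, Thm. 3.2 (p. 7)] -/
theorem finite_setOf_range_subvariety_iff_isReduced_endAlgebra (X : Motives.AbelianVariety K) :
    {R : Set X.X.left | ∃ (Z : Motives.AbelianVariety K) (j : Z ⟶ X),
        IsClosedImmersion (Hom.toSchemeHom j) ∧ R = Set.range (Hom.toSchemeHom j)}.Finite ↔ IsReduced X.endAlgebra := by
  rw [isReduced_endAlgebra_iff_isReduced_end, finite_setOf_range_subvariety_iff_isReduced_end]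

/-- `End⁰ X` is reduced iff `X ∼ ⨁_{q < r} B_q` with the `B_q` simple of positive dimension and pairwise non-isogenous (perfect
field): `End⁰ X = ⊕ M_{n_i}(D_i)` is reduced iff all `n_i = 1`. [cite: MumfordAV1970, §19 Cor. 1–2 of Thm. 1 (pp. 173–174)] -/
theorem isReduced_endAlgebra_iff_exists_isIsogenous_biproduct_simple (X : Motives.AbelianVariety K) :
    IsReduced X.endAlgebra ↔ ∃ (r : ℕ) (B : Fin r → Motives.AbelianVariety K), (∀ q, (B q).IsSimple) ∧
      (∀ q, 0 < (B q).dim) ∧ (∀ q q', q ≠ q' → ¬ IsIsogenous (B q) (B q')) ∧ IsIsogenous X (⨁ B) := by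
  rw [isReduced_endAlgebra_iff_isReduced_end, isReduced_end_iff_exists_isIsogenous_biproduct_simple]

/-- **A COMMUTATIVE `End⁰ X` IS REDUCED** (every abelian variety over a perfect field; the any-perfect-field form of the `K = ℂ`
statement `ComplexMultiplication/EndAlgebraCommutativeDegree.isReduced_endAlgebra_of_comm`): commutativity forces multiplicity
one in `End⁰ X = ⊕ M_{n_i}(D_i)`. [cite: MumfordAV1970, §19 Cor. 2 of Thm. 1 (p. 174)] [cite: Shimura1998, §5.1 Prop. 1, 3–4] -/
theorem isReduced_endAlgebra_of_forall_comm_endAlgebra (X : Motives.AbelianVariety K)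
    (hcomm : ∀ x y : X.endAlgebra, x * y = y * x) : IsReduced X.endAlgebra :=
  (finite_setOf_range_subvariety_iff_isReduced_endAlgebra X).1 (finite_setOf_range_subvariety_of_forall_comm_endAlgebra X hcomm)

/-- A commutative `End⁰ X` forces `End X` to be reduced (perfect field). [cite: MumfordAV1970, §19 Cor. 2 of Thm. 1 (p. 174)] -/
theorem isReduced_end_of_forall_comm_endAlgebra (X : Motives.AbelianVariety K)
    (hcomm : ∀ x y : X.endAlgebra, x * y = y * x) : _root_.IsReduced (End X) :=
  isReduced_endAlgebra_iff_isReduced_end.1 (isReduced_endAlgebra_of_forall_comm_endAlgebra X hcomm)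

/-- **FINITENESS OF THE SET OF ABELIAN SUBVARIETIES IS AN ISOGENY INVARIANT** (perfect field): it is read off `End⁰ X`, an
isogeny invariant. [cite: Zarhin2008HomomorphismsFiniteFields, Thm. 3.2 (p. 7)] [cite: MumfordAV1970, §19 Cor. 1–2 of Thm. 1 (pp. 173–174)] -/
theorem finite_setOf_range_subvariety_iff_of_isIsogenous (h : IsIsogenous X X') :
    {R : Set X.X.left | ∃ (Z : Motives.AbelianVariety K) (j : Z ⟶ X),
        IsClosedImmersion (Hom.toSchemeHom j) ∧ R = Set.range (Hom.toSchemeHom j)}.Finite ↔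
      {R : Set X'.X.left | ∃ (Z : Motives.AbelianVariety K) (j : Z ⟶ X'),
        IsClosedImmersion (Hom.toSchemeHom j) ∧ R = Set.range (Hom.toSchemeHom j)}.Finite := by
  rw [finite_setOf_range_subvariety_iff_isReduced_endAlgebra, finite_setOf_range_subvariety_iff_isReduced_endAlgebra,
    isReduced_endAlgebra_iff_of_isIsogenous h]

/-- … equivalently for infinitely many abelian subvarieties (perfect field). [cite: Zarhin2008HomomorphismsFiniteFields, Thm. 3.2 (p. 7)] -/
theorem infinite_setOf_range_subvariety_iff_of_isIsogenous (h : IsIsogenous X X') :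
    {R : Set X.X.left | ∃ (Z : Motives.AbelianVariety K) (j : Z ⟶ X),
        IsClosedImmersion (Hom.toSchemeHom j) ∧ R = Set.range (Hom.toSchemeHom j)}.Infinite ↔
      {R : Set X'.X.left | ∃ (Z : Motives.AbelianVariety K) (j : Z ⟶ X'),
        IsClosedImmersion (Hom.toSchemeHom j) ∧ R = Set.range (Hom.toSchemeHom j)}.Infinite := by
  rw [Set.Infinite, Set.Infinite, finite_setOf_range_subvariety_iff_of_isIsogenous h]

/-- **ISOGENOUS ABELIAN VARIETIES HAVE THE SAME NUMBER OF ABELIAN SUBVARIETIES** (perfect field; `Nat.card`, which is `0` for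
an infinite set): both are `2^r` when `X ∼ X' ∼ ⨁_{q < r} B_q` with pairwise non-isogenous simple `B_q`, and both sets are infinite
otherwise. [cite: MumfordAV1970, §19 Cor. 1–2 of Thm. 1 (pp. 173–174)] [cite: Zarhin2008HomomorphismsFiniteFields, Thm. 3.2 (p. 7)] -/
theorem natCard_setOf_range_subvariety_eq_of_isIsogenous (h : IsIsogenous X X') :
    Nat.card {R : Set X.X.left | ∃ (Z : Motives.AbelianVariety K) (j : Z ⟶ X),
        IsClosedImmersion (Hom.toSchemeHom j) ∧ R = Set.range (Hom.toSchemeHom j)} =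
      Nat.card {R : Set X'.X.left | ∃ (Z : Motives.AbelianVariety K) (j : Z ⟶ X'),
        IsClosedImmersion (Hom.toSchemeHom j) ∧ R = Set.range (Hom.toSchemeHom j)} := by
  by_cases hfin : {R : Set X.X.left | ∃ (Z : Motives.AbelianVariety K) (j : Z ⟶ X),
      IsClosedImmersion (Hom.toSchemeHom j) ∧ R = Set.range (Hom.toSchemeHom j)}.Finite
  · obtain ⟨r, B, hB, hB0, hni, hX⟩ := (finite_setOf_range_subvariety_iff_exists_isIsogenous_biproduct_simple X).1 hfin
    rw [natCard_setOf_range_subvariety_of_isIsogenous_biproduct_simple hB hB0 hni hX,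
      natCard_setOf_range_subvariety_of_isIsogenous_biproduct_simple hB hB0 hni (h.symm'.trans hX)]
  · have hfin' := fun h' ↦ hfin ((finite_setOf_range_subvariety_iff_of_isIsogenous h).2 h')
    rw [Set.Infinite.card_eq_zero hfin, Set.Infinite.card_eq_zero hfin']

end Perfect

end AbelianVariety

end Literature.AlgebraicGeometry.HodgeTheory

end
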